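import Summits.AtomisticToContinuum.Crystallization.Theorems.FreeSplittingCertificatesStrictSplittingRuleFarPencilFlux4
import Summits.AtomisticToContinuum.Crystallization.Theorems.FreeSplittingCertificatesStrictSplittingRuleFarPencilWeightedIntegrable

/-!
# `StrictSplittingRule` (stmt-AtomisticToContinuum-12560): the weighted far pencil for the GENERIC flux `aΦ₁ + bΦ₂ + cΦ₃ + nΨ₁` — integrability form

Route `FreeSplittingCertificates`, crux r3 `StrictSplittingRule` (H12⋆ = `stub_coreJointCoercive`), unit b2b-freesplit-B gen 18.
VALUE = the first of the three companion files announced in `…FarPencilFlux4.lean` (gen 17): the weighted integration-by-parts chain of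
`…FarPencilWeighted` / `…FarPencilWeightedIntegrable` (written for the ONE flux `fpFlux` of the `17/200` pencil) re-run for the generic flux
`fpFlux4 a b c n` and an ARBITRARY pointwise certificate `N(f_S,f_A,D,C) + div(aΦ₁ + bΦ₂ + cΦ₃ + nΨ₁) ≤ t·Den` (kept as an explicit
`∀`-hypothesis; discharged in the tree for the `17/200` pencil and the four inflated pencils A/B/C/D of HOME CERT.md §23 by
`farPencilCert_one/_A/_B/_C/_D`).  This is item (6) "integrated form of the inflated pencil" of HOME FAR-LEMMA-SPEC §14 (e) at the level of
`farPencil_weighted_integral_le_of_integrable` — NOT a proof of H12⋆, NOT summit progress.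

Content (`v ∈ C²`, `χ ∈ C²` with `0 ∉ tsupport χ`; no support condition on `v`, no condition at the reference site):
* `fpFlux4DotGrad a b c n v χ x = ⟪∇χ(x), Φ(x)⟫` (`fpFluxDotGrad = fpFlux4DotGrad 1 7 0 1`);
* continuity at every `y ≠ 0` of `Φⱼ`, `∂ₖΦⱼ`, `N`, `div Φ` along a `C²` field (`continuousAt_fpFlux4`, `…Flux4Deriv`, `…fpNumI`, `…fpDivFlux4`);
* `integral_sq_mul_fpFlux4Deriv_of_integrable`: `∫ Φⱼ·∂ⱼ(χ²) = −∫ χ²·∂ⱼΦⱼ` (Mathlib's integration by parts for line derivatives, weight `χ²`);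
* `integral_sq_mul_fpDivFlux4_of_integrable`: **`∫ χ²·div Φ = −∫ 2χ·⟪∇χ, Φ⟫`**;
* **`farPencil4_weighted_integral_le_of_integrable`**: given the pointwise certificate with receipts coefficient `t` and the integrability of
  `χ²·N`, `χ²·Den`, `χ²·∂ⱼΦⱼ`, `Φⱼ·∂ⱼ(χ²)`, `Φⱼ·χ²`:  `∫ χ²·N ≤ t·∫ χ²·Den + ∫ 2χ·⟪∇χ, Φ⟫` — the interface term (the NEAR flux the near half
  of the split pays, channels `(a, b+c, n)` of HOME CERT.md §23 (2)) is exact and lives where `∇χ ≠ 0`;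
* `farPencilD_weighted_integral_le_of_integrable`: the instance for the recommended certificate D (`t = 9/40`, flux `(7/45, 23/30, −19/40, 3/40)`).
The decay bookkeeping (linear-growth / affine-tailed fields) and the passage to the P1 class are the companion files `…FarPencilFlux4Growth`,
`…FarPencilFlux4LocallyAffine`.  HONEST FRAMING: theorems about continuum test fields and a weight; the lattice→continuum transfer and the near
certificate are untouched; NOT a proof of H12⋆, NOT summit progress.
-/

noncomputable section

open MeasureTheory Topology Filter

namespace Summit.AtomisticToContinuum.Crystallization.Theorems.StrictSplittingRuleBirth

attribute [local fun_prop] continuousAt_apply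

variable {v : (Fin 3 → ℝ) → (Fin 3 → ℝ)} {χ : (Fin 3 → ℝ) → ℝ}

/-! ## The interface density `⟪∇χ, Φ⟫` -/

/-- `⟪∇χ(x), Φ(x)⟫ = Σⱼ ∂ⱼχ · Φⱼ` for the generic flux `Φ = aΦ₁ + bΦ₂ + cΦ₃ + nΨ₁`. -/
def fpFlux4DotGrad (a b c n : ℝ) (v : (Fin 3 → ℝ) → (Fin 3 → ℝ)) (χ : (Fin 3 → ℝ) → ℝ) (x : Fin 3 → ℝ) : ℝ :=
  fpGradS χ x 0 * fpFlux4 a b c n v x 0 + fpGradS χ x 1 * fpFlux4 a b c n v x 1 + fpGradS χ x 2 * fpFlux4 a b c n v x 2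

/-- Consistency with the `17/200` pencil's interface density: `fpFluxDotGrad = fpFlux4DotGrad 1 7 0 1`. -/
theorem fpFluxDotGrad_eq_fpFlux4DotGrad (v : (Fin 3 → ℝ) → (Fin 3 → ℝ)) (χ : (Fin 3 → ℝ) → ℝ) (x : Fin 3 → ℝ) :
    fpFluxDotGrad v χ x = fpFlux4DotGrad 1 7 0 1 v χ x := by
  unfold fpFluxDotGrad fpFlux4DotGrad
  rw [fpFlux_eq_fpFlux4, fpFlux_eq_fpFlux4, fpFlux_eq_fpFlux4]

/-! ## Continuity of the generic densities away from the reference site -/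

section cont
variable (a b c n : ℝ) (hv : ContDiff ℝ 2 v) {y : Fin 3 → ℝ} (hy : y ≠ 0)
include hv hy

/-- The generic flux `Φⱼ` is continuous at every `y ≠ 0` (for a `C²` field). -/
theorem continuousAt_fpFlux4 (j : Fin 3) : ContinuousAt (fun z => fpFlux4 a b c n v z j) y := by
  have hvc : Continuous v := hv.continuous
  have hGc : Continuous (fpGrad v) := continuous_fpGrad hv
  have hρ : y 0 ^ 2 + y 1 ^ 2 + y 2 ^ 2 ≠ 0 := fpSq_ne_zero hy
  unfold fpFlux4 fpSq fpDot fpTr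
  fun_prop (disch := assumption)

/-- The generic flux derivative `∂ₖΦⱼ` is continuous at every `y ≠ 0` (for a `C²` field). -/
theorem continuousAt_fpFlux4Deriv (j k : Fin 3) : ContinuousAt (fun z => fpFlux4Deriv a b c n v z j k) y := by
  have hvc : Continuous v := hv.continuous
  have hGc : Continuous (fpGrad v) := continuous_fpGrad hv
  have hHc : Continuous (fpHess v) := continuous_fpHess hv
  have hρ : y 0 ^ 2 + y 1 ^ 2 + y 2 ^ 2 ≠ 0 := fpSq_ne_zero hy
  unfold fpFlux4Deriv fpSq fpDot fpTr
  fun_prop (disch := assumption)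

/-- The divergence density `fpDivFlux4` along the field is continuous at every `y ≠ 0`. -/
theorem continuousAt_fpDivFlux4 : ContinuousAt (fun z => fpDivFlux4 a b c n z (v z) (fpGrad v z)) y := by
  have hvc : Continuous v := hv.continuous
  have hGc : Continuous (fpGrad v) := continuous_fpGrad hv
  have hρ : y 0 ^ 2 + y 1 ^ 2 + y 2 ^ 2 ≠ 0 := fpSq_ne_zero hy
  unfold fpDivFlux4 fpSq fpDot fpTr fpTrSq fpXGV fpVGX
  fun_prop (disch := assumption)

omit a b c n in
/-- The inflated demand density `N(f_S,f_A,D,C)` along the field is continuous at every `y ≠ 0`. -/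
theorem continuousAt_fpNumI (fS fA D C : ℝ) : ContinuousAt (fun z => fpNumI fS fA D C z (v z) (fpGrad v z)) y := by
  have hvc : Continuous v := hv.continuous
  have hGc : Continuous (fpGrad v) := continuous_fpGrad hv
  have hρ : y 0 ^ 2 + y 1 ^ 2 + y 2 ^ 2 ≠ 0 := fpSq_ne_zero hy
  unfold fpNumI fpSymSq fpFrob fpDot fpSq
  fun_prop (disch := assumption)

end cont

/-! ## The pointwise certificate everywhere -/

/-- A pointwise certificate stated for `x ≠ 0` holds everywhere: at `x = 0` every density vanishes (`0⁻¹ = 0`). -/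
theorem farPencil4_pointwise_le' {fS fA D C a b c n t : ℝ}
    (hcert : ∀ (x v : Fin 3 → ℝ) (G : Fin 3 → Fin 3 → ℝ), x ≠ 0 → fpNumI fS fA D C x v G + fpDivFlux4 a b c n x v G ≤ t * fpDen x G)
    (x w : Fin 3 → ℝ) (G : Fin 3 → Fin 3 → ℝ) : fpNumI fS fA D C x w G + fpDivFlux4 a b c n x w G ≤ t * fpDen x G := by
  by_cases hx : x = 0
  · subst hx
    simp [fpNumI, fpDivFlux4, fpDen, fpSq]
  · exact hcert x w G hx

/-! ## Integration by parts with the weight `χ²` -/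

/-- **`∫ Φⱼ·∂ⱼ(χ²) = −∫ χ²·∂ⱼΦⱼ`** for the generic flux, from integrability alone (integration by parts for line derivatives, weight
`g = χ²`; the line derivative of `Φⱼ` is needed only on `tsupport χ² ∌ 0`). -/
theorem integral_sq_mul_fpFlux4Deriv_of_integrable (a b c n : ℝ) (hv : ContDiff ℝ 2 v) (hχ : ContDiff ℝ 2 χ)
    (hχ0 : (0 : Fin 3 → ℝ) ∉ tsupport χ) (j : Fin 3)
    (i1 : Integrable fun y => fpFlux4Deriv a b c n v y j j * χ y ^ 2)
    (i2 : Integrable fun y => fpFlux4 a b c n v y j * (2 * χ y * fpGradS χ y j))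
    (i3 : Integrable fun y => fpFlux4 a b c n v y j * χ y ^ 2) :
    ∫ y, fpFlux4 a b c n v y j * (2 * χ y * fpGradS χ y j) = - ∫ y, fpFlux4Deriv a b c n v y j j * χ y ^ 2 := by
  have h1 : ContDiff ℝ 1 (fderiv ℝ v) := hv.fderiv_right (by norm_num)
  have h := integral_bilinear_hasLineDerivAt_right_eq_neg_left_of_integrable
    (μ := (volume : Measure (Fin 3 → ℝ))) (B := ContinuousLinearMap.mul ℝ ℝ) (v := fpE j)
    (f := fun z => fpFlux4 a b c n v z j) (f' := fun y => fpFlux4Deriv a b c n v y j j)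
    (g := fun y => χ y ^ 2) (g' := fun y => 2 * χ y * fpGradS χ y j)
    (by simpa using i1) (by simpa using i2) (by simpa using i3)
    (fun y hy => by
      have hy0 : y ≠ 0 := by
        rintro rfl
        exact hχ0 ((tsupport_mul_subset_left (f := χ) (g := χ)) (by simpa [sq] using hy))
      exact hasLineDerivAt_fpFlux4 a b c n hy0 (hv.differentiable (by simp) y) (h1.differentiable (by simp) y) j j)
    (fun y _ => hasLineDerivAt_sq hχ y j)
  simpa using h

/-- Pointwise: `χ²·div Φ = Σⱼ χ²·∂ⱼΦⱼ` (trace identity at `y ≠ 0` for a `C²` field; both sides vanish where `χ = 0`, in particular at `0`). -/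
theorem sq_mul_fpDivFlux4_eq (a b c n : ℝ) (hv : ContDiff ℝ 2 v) (hχ0 : (0 : Fin 3 → ℝ) ∉ tsupport χ) (y : Fin 3 → ℝ) :
    χ y ^ 2 * fpDivFlux4 a b c n y (v y) (fpGrad v y) =
      fpFlux4Deriv a b c n v y 0 0 * χ y ^ 2 + fpFlux4Deriv a b c n v y 1 1 * χ y ^ 2 +
        fpFlux4Deriv a b c n v y 2 2 * χ y ^ 2 := by
  by_cases hy : y = 0
  · subst hy
    simp [image_eq_zero_of_notMem_tsupport hχ0]
  · rw [← sum_fpFlux4Deriv_eq_fpDivFlux4_of_contDiffAt a b c n v hy hv.contDiffAt]; ring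

/-- `χ²·div Φ` is integrable when the three `χ²·∂ⱼΦⱼ` are. -/
theorem integrable_sq_mul_fpDivFlux4_of_integrable (a b c n : ℝ) (hv : ContDiff ℝ 2 v) (hχ0 : (0 : Fin 3 → ℝ) ∉ tsupport χ)
    (i1 : ∀ j : Fin 3, Integrable fun y => fpFlux4Deriv a b c n v y j j * χ y ^ 2) :
    Integrable fun y => χ y ^ 2 * fpDivFlux4 a b c n y (v y) (fpGrad v y) := by
  have h : (fun y => χ y ^ 2 * fpDivFlux4 a b c n y (v y) (fpGrad v y)) =
      fun y => fpFlux4Deriv a b c n v y 0 0 * χ y ^ 2 + fpFlux4Deriv a b c n v y 1 1 * χ y ^ 2 +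
        fpFlux4Deriv a b c n v y 2 2 * χ y ^ 2 :=
    funext (sq_mul_fpDivFlux4_eq a b c n hv hχ0)
  rw [h]
  exact ((i1 0).add (i1 1)).add (i1 2)

/-- **`∫ χ²·div Φ = −∫ 2χ·⟪∇χ, Φ⟫`** for the generic flux, from integrability alone: the smeared interface flux. -/
theorem integral_sq_mul_fpDivFlux4_of_integrable (a b c n : ℝ) (hv : ContDiff ℝ 2 v) (hχ : ContDiff ℝ 2 χ)
    (hχ0 : (0 : Fin 3 → ℝ) ∉ tsupport χ)
    (i1 : ∀ j : Fin 3, Integrable fun y => fpFlux4Deriv a b c n v y j j * χ y ^ 2)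
    (i2 : ∀ j : Fin 3, Integrable fun y => fpFlux4 a b c n v y j * (2 * χ y * fpGradS χ y j))
    (i3 : ∀ j : Fin 3, Integrable fun y => fpFlux4 a b c n v y j * χ y ^ 2) :
    ∫ y, χ y ^ 2 * fpDivFlux4 a b c n y (v y) (fpGrad v y) = - ∫ y, 2 * χ y * fpFlux4DotGrad a b c n v χ y := by
  have hpt' : ∀ y, 2 * χ y * fpFlux4DotGrad a b c n v χ y =
      fpFlux4 a b c n v y 0 * (2 * χ y * fpGradS χ y 0) + fpFlux4 a b c n v y 1 * (2 * χ y * fpGradS χ y 1) +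
        fpFlux4 a b c n v y 2 * (2 * χ y * fpGradS χ y 2) := by
    intro y; unfold fpFlux4DotGrad; ring
  simp_rw [sq_mul_fpDivFlux4_eq a b c n hv hχ0, hpt']
  have e1 : ∫ y, (fpFlux4Deriv a b c n v y 0 0 * χ y ^ 2 + fpFlux4Deriv a b c n v y 1 1 * χ y ^ 2 +
      fpFlux4Deriv a b c n v y 2 2 * χ y ^ 2) =
      (∫ y, (fpFlux4Deriv a b c n v y 0 0 * χ y ^ 2 + fpFlux4Deriv a b c n v y 1 1 * χ y ^ 2)) +
        ∫ y, fpFlux4Deriv a b c n v y 2 2 * χ y ^ 2 :=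
    integral_add ((i1 0).add (i1 1)) (i1 2)
  have e2 : ∫ y, (fpFlux4Deriv a b c n v y 0 0 * χ y ^ 2 + fpFlux4Deriv a b c n v y 1 1 * χ y ^ 2) =
      (∫ y, fpFlux4Deriv a b c n v y 0 0 * χ y ^ 2) + ∫ y, fpFlux4Deriv a b c n v y 1 1 * χ y ^ 2 :=
    integral_add (i1 0) (i1 1)
  have e3 : ∫ y, (fpFlux4 a b c n v y 0 * (2 * χ y * fpGradS χ y 0) + fpFlux4 a b c n v y 1 * (2 * χ y * fpGradS χ y 1) +
      fpFlux4 a b c n v y 2 * (2 * χ y * fpGradS χ y 2)) =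
      (∫ y, (fpFlux4 a b c n v y 0 * (2 * χ y * fpGradS χ y 0) + fpFlux4 a b c n v y 1 * (2 * χ y * fpGradS χ y 1))) +
        ∫ y, fpFlux4 a b c n v y 2 * (2 * χ y * fpGradS χ y 2) := integral_add ((i2 0).add (i2 1)) (i2 2)
  have e4 : ∫ y, (fpFlux4 a b c n v y 0 * (2 * χ y * fpGradS χ y 0) + fpFlux4 a b c n v y 1 * (2 * χ y * fpGradS χ y 1)) =
      (∫ y, fpFlux4 a b c n v y 0 * (2 * χ y * fpGradS χ y 0)) + ∫ y, fpFlux4 a b c n v y 1 * (2 * χ y * fpGradS χ y 1) :=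
    integral_add (i2 0) (i2 1)
  rw [e1, e2, e3, e4, integral_sq_mul_fpFlux4Deriv_of_integrable a b c n hv hχ hχ0 0 (i1 0) (i2 0) (i3 0),
    integral_sq_mul_fpFlux4Deriv_of_integrable a b c n hv hχ hχ0 1 (i1 1) (i2 1) (i3 1),
    integral_sq_mul_fpFlux4Deriv_of_integrable a b c n hv hχ hχ0 2 (i1 2) (i2 2) (i3 2)]
  ring

/-! ## The weighted far pencil for a generic pointwise certificate -/

/-- **THE WEIGHTED CONTINUUM FAR PENCIL FOR A GENERIC POINTWISE CERTIFICATE, INTEGRABILITY FORM.**  Let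
`N(f_S,f_A,D,C) + div(aΦ₁ + bΦ₂ + cΦ₃ + nΨ₁) ≤ t·Den` hold pointwise at every `x ≠ 0` (e.g. `farPencilCert_D`: `(7/4,7/4,6/5,9/10)`,
flux `(7/45, 23/30, −19/40, 3/40)`, `t = 9/40`).  For every `C²` vector field `v : ℝ³ → ℝ³` (no support condition, no condition at the
reference site) and every `C²` weight `χ` with `0 ∉ tsupport χ`, if the weighted densities `χ²·N`, `χ²·Den`, `χ²·∂ⱼΦⱼ`, `Φⱼ·∂ⱼ(χ²)`, `Φⱼ·χ²`
are integrable, then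
`∫ χ²·N(x, v, ∇v) ≤ t·∫ χ²·Den(x, ∇v) + ∫ 2χ⟪∇χ, Φ⟫`, `Φ = fpFlux4 a b c n v`.
The interface term is exact (no Young waste) and lives where `∇χ ≠ 0` — it is the NEAR flux of HOME CERT.md §23 (2) with channel vector
`(a, b+c, n)`.  NOT a proof of H12⋆, NOT summit progress. -/
theorem farPencil4_weighted_integral_le_of_integrable {fS fA D C a b c n t : ℝ}
    (hcert : ∀ (x v : Fin 3 → ℝ) (G : Fin 3 → Fin 3 → ℝ), x ≠ 0 → fpNumI fS fA D C x v G + fpDivFlux4 a b c n x v G ≤ t * fpDen x G)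
    (hv : ContDiff ℝ 2 v) (hχ : ContDiff ℝ 2 χ) (hχ0 : (0 : Fin 3 → ℝ) ∉ tsupport χ)
    (iN : Integrable fun y => χ y ^ 2 * fpNumI fS fA D C y (v y) (fpGrad v y))
    (iD : Integrable fun y => χ y ^ 2 * fpDen y (fpGrad v y))
    (i1 : ∀ j : Fin 3, Integrable fun y => fpFlux4Deriv a b c n v y j j * χ y ^ 2)
    (i2 : ∀ j : Fin 3, Integrable fun y => fpFlux4 a b c n v y j * (2 * χ y * fpGradS χ y j))
    (i3 : ∀ j : Fin 3, Integrable fun y => fpFlux4 a b c n v y j * χ y ^ 2) :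
    ∫ x, χ x ^ 2 * fpNumI fS fA D C x (v x) (fpGrad v x) ≤
      t * (∫ x, χ x ^ 2 * fpDen x (fpGrad v x)) + ∫ x, 2 * χ x * fpFlux4DotGrad a b c n v χ x := by
  have iΦ := integrable_sq_mul_fpDivFlux4_of_integrable a b c n hv hχ0 i1
  have hpt : ∀ x, χ x ^ 2 * fpNumI fS fA D C x (v x) (fpGrad v x) + χ x ^ 2 * fpDivFlux4 a b c n x (v x) (fpGrad v x) ≤
      t * (χ x ^ 2 * fpDen x (fpGrad v x)) := by
    intro x
    have h := mul_le_mul_of_nonneg_left (farPencil4_pointwise_le' hcert x (v x) (fpGrad v x)) (sq_nonneg (χ x))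
    nlinarith [h]
  have h1 : (∫ x, χ x ^ 2 * fpNumI fS fA D C x (v x) (fpGrad v x)) + ∫ x, χ x ^ 2 * fpDivFlux4 a b c n x (v x) (fpGrad v x) ≤
      t * ∫ x, χ x ^ 2 * fpDen x (fpGrad v x) := by
    rw [← integral_add iN iΦ, ← integral_const_mul]
    exact integral_mono (iN.add iΦ) (iD.const_mul _) hpt
  rw [integral_sq_mul_fpDivFlux4_of_integrable a b c n hv hχ hχ0 i1 i2 i3] at h1
  linarith

/-- **Instance: the recommended inflated certificate D** (`…FarPencilInflatedD`, HOME CERT.md §23 (6): bond-midpoint bookkeeping target),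
integrability form: for `v ∈ C²`, `χ ∈ C²` with `0 ∉ tsupport χ` and the five weighted densities integrable,
`∫ χ²·N(7/4,7/4,6/5,9/10) ≤ (9/40)·∫ χ²·Den + ∫ 2χ⟪∇χ, Φ_D⟫`, `Φ_D = (7/45)Φ₁ + (23/30)Φ₂ − (19/40)Φ₃ + (3/40)Ψ₁`
(near flux channels `(a, b+c, n₁) = (7/45, 7/24, 3/40)`).  NOT a proof of H12⋆, NOT summit progress. -/
theorem farPencilD_weighted_integral_le_of_integrable (hv : ContDiff ℝ 2 v) (hχ : ContDiff ℝ 2 χ)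
    (hχ0 : (0 : Fin 3 → ℝ) ∉ tsupport χ)
    (iN : Integrable fun y => χ y ^ 2 * fpNumI (7 / 4) (7 / 4) (6 / 5) (9 / 10) y (v y) (fpGrad v y))
    (iD : Integrable fun y => χ y ^ 2 * fpDen y (fpGrad v y))
    (i1 : ∀ j : Fin 3, Integrable fun y => fpFlux4Deriv (7 / 45) (23 / 30) (-(19 / 40)) (3 / 40) v y j j * χ y ^ 2)
    (i2 : ∀ j : Fin 3, Integrable fun y => fpFlux4 (7 / 45) (23 / 30) (-(19 / 40)) (3 / 40) v y j * (2 * χ y * fpGradS χ y j))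
    (i3 : ∀ j : Fin 3, Integrable fun y => fpFlux4 (7 / 45) (23 / 30) (-(19 / 40)) (3 / 40) v y j * χ y ^ 2) :
    ∫ x, χ x ^ 2 * fpNumI (7 / 4) (7 / 4) (6 / 5) (9 / 10) x (v x) (fpGrad v x) ≤
      9 / 40 * (∫ x, χ x ^ 2 * fpDen x (fpGrad v x)) +
        ∫ x, 2 * χ x * fpFlux4DotGrad (7 / 45) (23 / 30) (-(19 / 40)) (3 / 40) v χ x :=
  farPencil4_weighted_integral_le_of_integrable farPencilCert_D hv hχ hχ0 iN iD i1 i2 i3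

/-- Consistency check of the interface: the `17/200` pencil's integrability form (`farPencil_weighted_integral_le_of_integrable`,
`…FarPencilWeightedIntegrable`) is the instance `(1,1,1,1)`, flux `(1/18)(Φ₁ + 7Φ₂ + Ψ₁)`, `t = 17/200` of the generic theorem, up to the
rewriting `fpNum = fpNumI 1 1 1 1` and `(1/18)·(2χ⟪∇χ, fpFlux⟫) = 2χ⟪∇χ, fpFlux4 (1/18) (7/18) 0 (1/18)⟫` — stated here on the generic side. -/
example (hv : ContDiff ℝ 2 v) (hχ : ContDiff ℝ 2 χ) (hχ0 : (0 : Fin 3 → ℝ) ∉ tsupport χ)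
    (iN : Integrable fun y => χ y ^ 2 * fpNumI 1 1 1 1 y (v y) (fpGrad v y))
    (iD : Integrable fun y => χ y ^ 2 * fpDen y (fpGrad v y))
    (i1 : ∀ j : Fin 3, Integrable fun y => fpFlux4Deriv (1 / 18) (7 / 18) 0 (1 / 18) v y j j * χ y ^ 2)
    (i2 : ∀ j : Fin 3, Integrable fun y => fpFlux4 (1 / 18) (7 / 18) 0 (1 / 18) v y j * (2 * χ y * fpGradS χ y j))
    (i3 : ∀ j : Fin 3, Integrable fun y => fpFlux4 (1 / 18) (7 / 18) 0 (1 / 18) v y j * χ y ^ 2) :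
    ∫ x, χ x ^ 2 * fpNumI 1 1 1 1 x (v x) (fpGrad v x) ≤
      17 / 200 * (∫ x, χ x ^ 2 * fpDen x (fpGrad v x)) +
        ∫ x, 2 * χ x * fpFlux4DotGrad (1 / 18) (7 / 18) 0 (1 / 18) v χ x :=
  farPencil4_weighted_integral_le_of_integrable farPencilCert_one hv hχ hχ0 iN iD i1 i2 i3

end Summit.AtomisticToContinuum.Crystallization.Theorems.StrictSplittingRuleBirth
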